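import Literature.NumberTheory.Rogawski1990.ArchOrbFamGExtRealWallContinuous   -- ★ p850625 (F0P3b-p01 (g15)): §1 glue `hcExtendG_eqOn_of_continuousOn`, §3 `orbFamG_insert_eq_splitCofactor_mul`; brings ★ p850413 `continuous_splitCofactor`
import Literature.NumberTheory.Automorphic.ArchRankOneSplitOrbitSmooth          -- ★ (A0-smooth) p850603 (this seat): `exists_contDiff_abs_sub_smul_integral_descConj_hypBlockGL_eq_param`; brings ★ `isClosedEmbedding_coe_unitaryGroupOfForm_of_eq_over`
import Literature.NumberTheory.Automorphic.ArchRankOneSplitIwasawa             -- ★ (IWA) p850256 (this seat, g19): `K₁ = {k_s}`, `exists_rotLift_mul_mem_borelU`, `isCompact_range_rotLift`, `isHaarMeasure_map_rotLift`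
import Literature.NumberTheory.Automorphic.ArchRankOneSplitOrbitChart          -- ★ FILE 1 (this seat, g19): `exists_measure_quotient_torusU_complex_two_eq_smul_map`
import Literature.NumberTheory.Rogawski1990.ArchCayleyValueOfMembership        -- ★ p850419 (LH4-p01 (g3)) (V1-G′): the `x`-ray `hcCayPt p + x • e_{w₀,0}`, `cayRay_apply_*`, `tendsto_cayRay`; brings ★ `hcCayPt_mem_inRegG_insert`
import Literature.NumberTheory.Rogawski1990.ArchOrbFamGExtWallFactorWick       -- ★ p851055 (LH1-p03 (g5)) (R4)∕(B-wick): `archERhoG_mul_splitCofactor_eq_splitWallFactorR` (`e^{ρ}·cof = R♯` on the `x`-ray, through `x = 0`)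
import Literature.NumberTheory.Rogawski1990.ArchOrbFamGExtTwoChartDescent       -- ★ p851074 (LH3-p04 (g4)) road (α): `exists_descent_twoChart_chartOrbG` (ONE `K`, ONE `f` on both charts); brings ★ p850571 `measure_boxStd_ne_zero`, ★ `isInvInvariant_of_comm`
import HarnessLib

/-!
# (B-desc-hyp), road (β): THE VALUE OF `orbFamGExt ν′ a′ (S ∪ {w₀})` ON A BOX THROUGH THE REAL WALL `x_{w₀} = 0` from the split-side descent identity —
# `'F_{S∪w₀}(c) = cof(c) · K · G(B c, x_c, θ_c)` with `G` the SMOOTH extension of `|eˣ − e⁻ˣ| · ∫_{U(J)∕A} f_{B c}(h a_{x,θ} h⁻¹)` across `x = 0`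
# (Harish-Chandra; Varadarajan 1989 §6.4 Thm 23; Rogawski 1990 §8.2 p. 119, §4.12; Shelstad 1979 §4 Lemma 4.3; Bouaziz 1994 §3.1–3.2)

Topic `NumberTheory/Rogawski1990`; namespaces `Literature.NumberTheory.Automorphic.UnitaryGroup` (§1, the rank-one token) and `Literature.NumberTheory.Rogawski1990` (§2–§3).
THEOREMS ONLY (no `def`, no instance, no notation, no axiom, no named fact, no `sorry`); kernel lane `--kind proof --supports stmt-HodgeConjecture-24833`.  Cell `pub/hodgecm-mathlib`,
crux H413 (`stmt-HodgeConjecture-24833`), F0∕P3c line LH3 (closer stub `stub_N9`, N9″ DIRECT ROAD), letter L1 `HcOrbitalFamiliesStatement`, clause (I₃) spec SPEC-I3 v1.1 §5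
brick **(B-desc-hyp) «REAL-RAY DESCENT AT THE CAYLEY POINT»** (LH3-plan (g3) 10:14:12Z → F0P3a-p05 (g20); split 10:25:06Z∕10:25:29Z: road (α) = the TWO-CHART descent with the
SHARED block function `f` — LH3-p04 (g4), `ArchOrbFamGExtTwoChartDescent`; road (β) = THIS FILE, the dress through the wall in BINDER form over (α)'s split identity).

THE MATHEMATICS.  On the split chart `S ∪ {w₀}` near the Cayley point of a semiregular wall point, suppose Harish-Chandra's descent has been carried to the rank-one block
(road (α), ★ D4b + ★ block reduction): for `c` in an open `U`, `G`-regular, `chartOrbG (S ∪ {w₀}) a′ c = K · ∫_{U(J)∕A} f_{B c}(h · a_{x_c, θ_c} · h⁻¹) dμ₀′` with `a_{x,θ} = hypBlockGL x θ`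
the hyperbolic block element, `f : Q × M₂(ℂ) → ℂ` the (smooth, uniformly compactly supported) block function and `B : U → Q` the continuous base (tangential) coordinates.  Since
`orbFamG (S ∪ {w₀}) = cof · (|e^{x} − e^{−x}| · chartOrbG (S ∪ {w₀}))` (★ `orbFamG_insert_eq_splitCofactor_mul`, `cof` continuous) and the normalised split-torus orbital integral
`|eˣ − e⁻ˣ| · ∫_{U(J)∕A} f_q(h a_{x,θ} h⁻¹) dμ₀′` is the restriction to `x ≠ 0` of a jointly SMOOTH `G(q, x, θ)` (★ (A0-smooth), for `μ₀′` of Iwasawa form — i.e. EVERY non-zero invariant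
Radon measure on `U(J)∕A`, ★ `exists_measure_quotient_torusU_complex_two_eq_smul_map`; §1), the raw member equals the continuous `cof · K · G(B ·, x, θ)` on `U ∩ RegG`, hence its
`RegG`-limit extension `orbFamGExt` equals it on `U ∩ InRegG (slotSign L α) (S ∪ {w₀})` — THROUGH the real wall (★ glue `hcExtendG_eqOn_of_continuousOn`; §2).  On the `x`-ray
`c = hcCayPt w₀ 0 2 p + x • e_{w₀,0}` this is SPEC-I3 §5's `e^{ρ}·'F = K″ · R♯ p x · Λ f x` up to the wall-factor bookkeeping `e^{ρ}_{S∪w₀} · cof = R♯` ((R4)∕(B-wick), LH1-p03 (g5)) (§3).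

* §1 (ns `…Automorphic.UnitaryGroup`) **`exists_contDiff_absSub_smul_integral_descConj_hypBlockGL_eq_of_ne_zero`** — for EVERY invariant Radon `μ ≠ 0` on `U(J) ⧸ A_J` and every smooth
  `f : Q × M₂(ℂ) → E` with uniform compact `X`-support: `∃ G, ContDiff ℝ ∞ G ∧ ∀ q x θ, x ≠ 0 → |eˣ − e⁻ˣ| • ∫ descConj (a_{x,θ}) A (f_q ∘ ↑↑) ∂μ = G (q, x, θ)` (★ (A0-smooth) ∘ ★ Iwasawa).
* §2 (ns `…Rogawski1990`) **`orbFamGExt_eqOn_cofactor_mul_of_splitDescent`** (binder form: `hdesc♯` on `U ∩ RegG`, any continuous `G` agreeing with the token on `U ∩ RegG`),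
  **`exists_contDiff_orbFamGExt_eqOn_of_splitDescent`** (`G` supplied by §1; `B c := update c w₀ (0, c_{w₀,1}, 0)` = road (α)'s reading).
* §3 **`exists_contDiff_orbFamGExt_cayRay_eq_of_splitDescent`** (the `x`-RAY form: `∃ δ > 0, ∀ x, |x| < δ → orbFamGExt … (cayRay x) = cof(cayRay x) · (K · G (π p, x, p_{w₀,0}))`),
  **`exists_contDiff_archERhoG_mul_orbFamGExt_cayRay_eq_of_splitDescent`** (SPEC §5 VERBATIM SHAPE: `e^{ρ}_{S∪w₀}(cayRay x) · orbFamGExt … (cayRay x) = K · R♯ p x · G (π p, x, p_{w₀,0})`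
  for `|x| < δ`, `R♯ p x = (‖e^{x+ip₀} − e^{ip₁}‖·‖e^{−x+ip₀} − e^{ip₁}‖) · Π p` — ★ LH1-p03 `archERhoG_mul_splitCofactor_eq_splitWallFactorR`).
HONEST SCOPE: binder form over road (α)'s split identity (LH3-p04 (g4) discharges `hdesc♯` with the SHARED `f`); the Wick rotation `(R)⁽ʲ⁾(0) = I^{j+1}(R♯)⁽ʲ⁾(0)` is LH1-p03's ★
p851055; ONE real wall, semiregular points.
HONEST LABEL: HC_CM is proved only modulo the 7 printed citations (2 remaining named inputs: hLiu418 = `stmt-HodgeConjecture-24832`, h413 = `stmt-HodgeConjecture-24833`) until rung 0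
closes; count-neutral (a letter-L1 (I₃) pay-down; no stub closes by this file alone).

## References
* [Varadarajan1989] V. S. Varadarajan, *An Introduction to Harmonic Analysis on Semisimple Lie Groups*, Cambridge Stud. Adv. Math. 16 (1989), §6.4 Lemma 21, Thm 23.
* [Rogawski1990] J. D. Rogawski, *Automorphic Representations of Unitary Groups in Three Variables*, Ann. of Math. Stud. 123 (1990), §4.12 Lemma 4.12.1 p. 66; §8.2 pp. 118–119.
* [Shelstad1979] D. Shelstad, *Characters and inner forms of a quasi-split group over ℝ*, Compositio Math. 39 (1979) 11–45, §4 p. 22, Lemma 4.3 (p. 25), Prop. 4.5 (p. 26).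
* [Bouaziz1994IntegralesOrbitales] A. Bouaziz, *Intégrales orbitales sur les groupes de Lie réductifs*, Ann. Sci. ÉNS 27 (1994), §3.1 (I₂) p. 579; §3.2 (I₃) p. 580.
* [Varadarajan1977] V. S. Varadarajan, *Harmonic Analysis on Real Reductive Groups*, LNM 576 (1977), Part I §1.12.
* [HormanderALPDO1] L. Hörmander, *The Analysis of Linear Partial Differential Operators I* (1983), Thm. 1.1.9 (differentiation under the integral).
* [Borel1997] A. Borel, *Automorphic Forms on SL₂(ℝ)*, Cambridge Tracts in Math. 130 (1997), §2.5 (Iwasawa).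
-/

set_option autoImplicit false

noncomputable section

open MeasureTheory MeasureTheory.Measure Set Filter Topology NumberField NumberField.InfinitePlace Complex
open Literature.MeasureTheory.Group Literature.NumberTheory.Automorphic Literature.NumberTheory.Automorphic.UnitaryGroup Literature.NumberTheory.Automorphic.ArchCartan
open Literature.NumberTheory.Rogawski1990
open scoped MatrixGroups Matrix Pointwise NNReal Classical ContDiff
open scoped Matrix.Norms.Operator

/-! ## §1 The smooth split token for EVERY non-zero invariant Radon measure on `U(J) ⧸ A_J` -/

namespace Literature.NumberTheory.Automorphic

namespace UnitaryGroup

/-- **THE SMOOTH SPLIT TOKEN, hypothesis-free in the measure.**  `J` antidiagonal, `μ ≠ 0` an invariant Radon measure on `U(J) ⧸ A_J`, `f : Q × M₂(ℂ) → E` smooth with all `f_q`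
supported in one compact set of matrices.  Then there is a jointly SMOOTH `G : Q × ℝ × ℝ → E` with
**`|eˣ − e⁻ˣ| • ∫_{U(J)⧸A} f_q(↑↑(y a_{x,θ} y⁻¹)) dμ(y) = G (q, x, θ)` for every `x ≠ 0`** — Harish-Chandra's `F_f^A ∈ C^∞(A)`, jointly in a smooth parameter: ★ (A0-smooth)
`exists_contDiff_abs_sub_smul_integral_descConj_hypBlockGL_eq_param` with its Iwasawa binder `hμC` discharged by ★ `exists_measure_quotient_torusU_complex_two_eq_smul_map` along
the circle `K₁ = {k_s}` (★ `isCompact_range_rotLift`, ★ `exists_rotLift_mul_mem_borelU`, ★ `isHaarMeasure_map_rotLift`) and the compact `U(J)`-support read through the closed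
embedding `U(J) ↪ M₂(ℂ)` (★ `isClosedEmbedding_coe_unitaryGroupOfForm_of_eq_over`). [cite: Varadarajan1989, §6.4 Lemma 21, Thm 23] [cite: Shelstad1979, Lemma 4.3 p. 25]
[cite: HormanderALPDO1, Thm. 1.1.9] [cite: Borel1997, §2.5] -/
theorem exists_contDiff_absSub_smul_integral_descConj_hypBlockGL_eq_of_ne_zero
    {J : Matrix (Fin 2) (Fin 2) ℂ} (hJ : J = (StdForm.antidiagonal 2).over ℂ)
    [MeasurableSpace ↥(unitaryGroupOfForm (starRingEnd ℂ) J)] [BorelSpace ↥(unitaryGroupOfForm (starRingEnd ℂ) J)]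
    [MeasurableSpace (↥(unitaryGroupOfForm (starRingEnd ℂ) J) ⧸ torusU (starRingEnd ℂ) J)] [BorelSpace (↥(unitaryGroupOfForm (starRingEnd ℂ) J) ⧸ torusU (starRingEnd ℂ) J)]
    (μ : Measure (↥(unitaryGroupOfForm (starRingEnd ℂ) J) ⧸ torusU (starRingEnd ℂ) J))
    [SMulInvariantMeasure ↥(unitaryGroupOfForm (starRingEnd ℂ) J) (↥(unitaryGroupOfForm (starRingEnd ℂ) J) ⧸ torusU (starRingEnd ℂ) J) μ] [IsFiniteMeasureOnCompacts μ] (hμ : μ ≠ 0)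
    {E : Type*} [NormedAddCommGroup E] [NormedSpace ℝ E] [CompleteSpace E]
    {Q : Type*} [NormedAddCommGroup Q] [NormedSpace ℝ Q] [FiniteDimensional ℝ Q]
    (f : Q × Matrix (Fin 2) (Fin 2) ℂ → E) (hf : ContDiff ℝ ∞ f) {C : Set (Matrix (Fin 2) (Fin 2) ℂ)} (hC : IsCompact C) (hfC : ∀ q X, X ∉ C → f (q, X) = 0) :
    ∃ G : Q × ℝ × ℝ → E, ContDiff ℝ ∞ G ∧
      ∀ (q : Q) (x θ : ℝ), x ≠ 0 →
        |Real.exp x - Real.exp (-x)| •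
          ∫ y, descConj (⟨hypBlockGL x θ, hypBlockGL_mem_of_eq_over hJ x θ⟩ : ↥(unitaryGroupOfForm (starRingEnd ℂ) J)) (torusU (starRingEnd ℂ) J)
            (LineRing.forall_mem_torusU_comm (starRingEnd ℂ) J (hypBlockGL_mem_torusU hJ x θ))
            (fun h : ↥(unitaryGroupOfForm (starRingEnd ℂ) J) => f (q, ((h : GL (Fin 2) ℂ) : Matrix (Fin 2) (Fin 2) ℂ))) y ∂μ = G (q, x, θ) := by
  -- instances on `U(J)`, `A_J`, `N`
  haveI : LocallyCompactSpace ↥(unitaryGroupOfForm (starRingEnd ℂ) J) := locallyCompactSpace_unitaryGroupOfForm_complex J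
  haveI : SecondCountableTopology ↥(unitaryGroupOfForm (starRingEnd ℂ) J) := secondCountableTopology_unitaryGroupOfForm_complex J
  have hTUc : IsClosed ((torusU (starRingEnd ℂ) J : Subgroup ↥(unitaryGroupOfForm (starRingEnd ℂ) J)) : Set ↥(unitaryGroupOfForm (starRingEnd ℂ) J)) :=
    LineRing.isClosed_torusU_two _ _
  have hNc : IsClosed ((unipotentU (starRingEnd ℂ) J : Subgroup ↥(unitaryGroupOfForm (starRingEnd ℂ) J)) : Set ↥(unitaryGroupOfForm (starRingEnd ℂ) J)) :=
    LineRing.isClosed_unipotentU _ _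
  haveI : LocallyCompactSpace ↥(torusU (starRingEnd ℂ) J) := hTUc.isClosedEmbedding_subtypeVal.locallyCompactSpace
  haveI : SecondCountableTopology ↥(torusU (starRingEnd ℂ) J) := TopologicalSpace.Subtype.secondCountableTopology _
  haveI : BorelSpace ↥(torusU (starRingEnd ℂ) J) := Subtype.borelSpace _
  haveI : LocallyCompactSpace ↥(unipotentU (starRingEnd ℂ) J) := hNc.isClosedEmbedding_subtypeVal.locallyCompactSpace
  haveI : SecondCountableTopology ↥(unipotentU (starRingEnd ℂ) J) := TopologicalSpace.Subtype.secondCountableTopology _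
  haveI : BorelSpace ↥(unipotentU (starRingEnd ℂ) J) := Subtype.borelSpace _
  haveI : Fact (0 < 2 * Real.pi) := ⟨Real.two_pi_pos⟩
  -- the circle `K₁ = {k_s}` as a subgroup of `U(J)`: compact, `U(J) = K₁ · B`, Haar measure `κK = (s ↦ k_s)_* ds`
  obtain ⟨K₁, hK₁def⟩ : ∃ K₁ : Subgroup ↥(unitaryGroupOfForm (starRingEnd ℂ) J), (K₁ : Set ↥(unitaryGroupOfForm (starRingEnd ℂ) J)) =
      Set.range (fun s : AddCircle (2 * Real.pi) =>
        (⟨archPlaneLiftGL 1 (rotMat s) (det_rotMat s), archPlaneLiftGL_rotMat_mem hJ s⟩ : ↥(unitaryGroupOfForm (starRingEnd ℂ) J))) :=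
    ⟨{ carrier := Set.range (fun s : AddCircle (2 * Real.pi) =>
          (⟨archPlaneLiftGL 1 (rotMat s) (det_rotMat s), archPlaneLiftGL_rotMat_mem hJ s⟩ : ↥(unitaryGroupOfForm (starRingEnd ℂ) J)))
       one_mem' := ⟨0, Subtype.ext archPlaneLiftGL_rotMat_zero⟩
       mul_mem' := by
         rintro _ _ ⟨s, rfl⟩ ⟨t, rfl⟩
         exact ⟨s + t, Subtype.ext (archPlaneLiftGL_rotMat_add s t)⟩
       inv_mem' := by
         rintro _ ⟨s, rfl⟩
         exact ⟨-s, Subtype.ext (by rw [Subgroup.coe_inv]; exact archPlaneLiftGL_rotMat_neg s)⟩ }, rfl⟩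
  have hKmem : ∀ s : AddCircle (2 * Real.pi),
      (⟨archPlaneLiftGL 1 (rotMat s) (det_rotMat s), archPlaneLiftGL_rotMat_mem hJ s⟩ : ↥(unitaryGroupOfForm (starRingEnd ℂ) J)) ∈ K₁ := fun s => by
    rw [← SetLike.mem_coe, hK₁def]; exact ⟨s, rfl⟩
  have hKmem' : ∀ k ∈ K₁, ∃ s : AddCircle (2 * Real.pi),
      k = (⟨archPlaneLiftGL 1 (rotMat s) (det_rotMat s), archPlaneLiftGL_rotMat_mem hJ s⟩ : ↥(unitaryGroupOfForm (starRingEnd ℂ) J)) := fun k hk => by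
    rw [← SetLike.mem_coe, hK₁def] at hk
    obtain ⟨s, hs⟩ := hk
    exact ⟨s, hs.symm⟩
  have hK₁ : IsCompact (K₁ : Set ↥(unitaryGroupOfForm (starRingEnd ℂ) J)) := by rw [hK₁def]; exact isCompact_range_rotLift hJ
  have hKB : ∀ g : ↥(unitaryGroupOfForm (starRingEnd ℂ) J), ∃ k ∈ K₁, ∃ b ∈ borelU (starRingEnd ℂ) J, g = k * b := by
    intro g
    obtain ⟨s, b, hb, hg⟩ := exists_rotLift_mul_mem_borelU hJ g
    exact ⟨_, hKmem s, b, hb, hg⟩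
  haveI : CompactSpace ↥K₁ := isCompact_iff_compactSpace.1 hK₁
  haveI : BorelSpace ↥K₁ := Subtype.borelSpace _
  haveI hκH := isHaarMeasure_map_rotLift hJ K₁ hKmem hKmem'
  obtain ⟨C₀, -, hμC⟩ := exists_measure_quotient_torusU_complex_two_eq_smul_map hJ hK₁ hKB
    (Measure.map (fun s : AddCircle (2 * Real.pi) =>
      ((⟨⟨archPlaneLiftGL 1 (rotMat s) (det_rotMat s), archPlaneLiftGL_rotMat_mem hJ s⟩, hKmem s⟩ : ↥K₁))) (volume : Measure (AddCircle (2 * Real.pi))))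
    (Measure.haar : Measure ↥(torusU (starRingEnd ℂ) J)) (Measure.haar : Measure ↥(unipotentU (starRingEnd ℂ) J)) μ hμ
  -- the compact `U(J)`-support of the family, through the closed embedding `U(J) ↪ M₂(ℂ)`
  have hS₀ : IsCompact ((fun g : ↥(unitaryGroupOfForm (starRingEnd ℂ) J) => ((g : GL (Fin 2) ℂ) : Matrix (Fin 2) (Fin 2) ℂ)) ⁻¹' C) :=
    (isClosedEmbedding_coe_unitaryGroupOfForm_of_eq_over hJ).isCompact_preimage hC
  -- ★ (A0-smooth)
  obtain ⟨G, hG, hGeq, -⟩ := exists_contDiff_abs_sub_smul_integral_descConj_hypBlockGL_eq_param hJ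
    (Measure.map (fun s : AddCircle (2 * Real.pi) =>
      ((⟨⟨archPlaneLiftGL 1 (rotMat s) (det_rotMat s), archPlaneLiftGL_rotMat_mem hJ s⟩, hKmem s⟩ : ↥K₁))) (volume : Measure (AddCircle (2 * Real.pi))))
    (Measure.haar : Measure ↥(unipotentU (starRingEnd ℂ) J)) μ hK₁ hμC
    (fun (q : Q) (g : ↥(unitaryGroupOfForm (starRingEnd ℂ) J)) => f (q, ((g : GL (Fin 2) ℂ) : Matrix (Fin 2) (Fin 2) ℂ))) f hf (fun _ _ => rfl)
    hS₀ (fun q g hg => hfC q _ hg)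
  exact ⟨G, hG, fun q x θ hx => hGeq (q, x, θ) hx⟩

end UnitaryGroup

end Literature.NumberTheory.Automorphic

/-! ## §2 The dress: the value of `orbFamGExt (S ∪ {w₀})` on a box through the real wall, from the split-side descent identity -/

namespace Literature.NumberTheory.Rogawski1990

section Dress

variable (L : Type) [Field L] [NumberField L] [IsCMField L] (α : Fin 3 → L)
  [MeasurableSpace ↥(arch (↥(maximalRealSubfield L)) L (IsCMField.complexConj L) 3 (Matrix.diagonal α))]
  [BorelSpace ↥(arch (↥(maximalRealSubfield L)) L (IsCMField.complexConj L) 3 (Matrix.diagonal α))]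
  (ν' : Measure ↥(arch (↥(maximalRealSubfield L)) L (IsCMField.complexConj L) 3 (Matrix.diagonal α))) [ν'.IsHaarMeasure] [ν'.IsMulRightInvariant]
  (a' : ↥(arch (↥(maximalRealSubfield L)) L (IsCMField.complexConj L) 3 (Matrix.diagonal α)) → ℂ)
  (S : Finset {w : InfinitePlace L // IsComplex w}) (w₀ : {w : InfinitePlace L // IsComplex w})
  {J : Matrix (Fin 2) (Fin 2) ℂ} (hJ : J = (StdForm.antidiagonal 2).over ℂ)
  [MeasurableSpace ↥(unitaryGroupOfForm (starRingEnd ℂ) J)] [BorelSpace ↥(unitaryGroupOfForm (starRingEnd ℂ) J)]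
  [MeasurableSpace (↥(unitaryGroupOfForm (starRingEnd ℂ) J) ⧸ torusU (starRingEnd ℂ) J)] [BorelSpace (↥(unitaryGroupOfForm (starRingEnd ℂ) J) ⧸ torusU (starRingEnd ℂ) J)]
  (μ₀' : Measure (↥(unitaryGroupOfForm (starRingEnd ℂ) J) ⧸ torusU (starRingEnd ℂ) J))

omit [MeasurableSpace ↥(unitaryGroupOfForm (starRingEnd ℂ) J)] [BorelSpace ↥(unitaryGroupOfForm (starRingEnd ℂ) J)]
  [BorelSpace (↥(unitaryGroupOfForm (starRingEnd ℂ) J) ⧸ torusU (starRingEnd ℂ) J)] in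
/-- **THE VALUE OF `orbFamGExt ν′ a′ (S ∪ {w₀})` ON A BOX THROUGH THE REAL WALL — BINDER FORM.**  On the split chart `S ∪ {w₀}` (admissible) let `U` be open and suppose the
SPLIT-SIDE DESCENT IDENTITY (road (α)) `chartOrbG (S ∪ {w₀}) a′ c = K · ∫_{U(J)⧸A} f_{B c}(↑↑(y a_{x_c,θ_c} y⁻¹)) dμ₀′` on `U ∩ RegG (S ∪ {w₀})` (`a_{x,θ} = hypBlockGL x θ`, `x_c = c w₀ 0`,
`θ_c = c w₀ 2`, base map `B` continuous on `U`), and let `G` be continuous with `G (B c, x_c, θ_c) = |e^{x_c} − e^{−x_c}| • ∫ … dμ₀′` on `U ∩ RegG`.  Then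
**`orbFamGExt ν′ a′ (S ∪ {w₀}) c = cof(c) · (K · G (B c, x_c, θ_c))` for every `c ∈ U ∩ InRegG (slotSign L α) (S ∪ {w₀})`** — ON the real wall included: the raw member is
`cof · |eˣ − e⁻ˣ| · chartOrbG` (★ `orbFamG_insert_eq_splitCofactor_mul`), and the `RegG`-limit extension of a member with a continuous model on `U` IS that model (★
`hcExtendG_eqOn_of_continuousOn`). [cite: Varadarajan1989, §6.4 Thm 23] [cite: Varadarajan1977, I §1.12] [cite: Rogawski1990, §8.2 pp. 118–119] [cite: Shelstad1979, §4 Lemma 4.3 (p. 25)]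
[cite: Bouaziz1994IntegralesOrbitales, §3.1 (I₂) p. 579] -/
theorem orbFamGExt_eqOn_cofactor_mul_of_splitDescent (hS' : ∀ w', w' ∈ insert w₀ S → w' ∈ splitChartPlaces L α)
    {U : Set ({w : InfinitePlace L // IsComplex w} → Fin 3 → ℝ)} (hU : IsOpen U)
    {Q : Type*} [TopologicalSpace Q] {B : ({w : InfinitePlace L // IsComplex w} → Fin 3 → ℝ) → Q} (hB : ContinuousOn B U)
    {K : ℂ} {f : Q × Matrix (Fin 2) (Fin 2) ℂ → ℂ}
    (hdesc : ∀ c ∈ U ∩ RegG (insert w₀ S), chartOrbG L α ν' (insert w₀ S) a' c =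
      K * ∫ y, descConj (⟨hypBlockGL (c w₀ 0) (c w₀ 2), hypBlockGL_mem_of_eq_over hJ (c w₀ 0) (c w₀ 2)⟩ : ↥(unitaryGroupOfForm (starRingEnd ℂ) J)) (torusU (starRingEnd ℂ) J)
        (LineRing.forall_mem_torusU_comm (starRingEnd ℂ) J (hypBlockGL_mem_torusU hJ (c w₀ 0) (c w₀ 2)))
        (fun h : ↥(unitaryGroupOfForm (starRingEnd ℂ) J) => f (B c, ((h : GL (Fin 2) ℂ) : Matrix (Fin 2) (Fin 2) ℂ))) y ∂μ₀')
    {G : Q × ℝ × ℝ → ℂ} (hGc : Continuous G)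
    (hG : ∀ c ∈ U ∩ RegG (insert w₀ S),
      |Real.exp (c w₀ 0) - Real.exp (-(c w₀ 0))| •
        ∫ y, descConj (⟨hypBlockGL (c w₀ 0) (c w₀ 2), hypBlockGL_mem_of_eq_over hJ (c w₀ 0) (c w₀ 2)⟩ : ↥(unitaryGroupOfForm (starRingEnd ℂ) J)) (torusU (starRingEnd ℂ) J)
          (LineRing.forall_mem_torusU_comm (starRingEnd ℂ) J (hypBlockGL_mem_torusU hJ (c w₀ 0) (c w₀ 2)))
          (fun h : ↥(unitaryGroupOfForm (starRingEnd ℂ) J) => f (B c, ((h : GL (Fin 2) ℂ) : Matrix (Fin 2) (Fin 2) ℂ))) y ∂μ₀' = G (B c, c w₀ 0, c w₀ 2)) :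
    EqOn (orbFamGExt L α ν' a' (insert w₀ S))
      (fun c : {w : InfinitePlace L // IsComplex w} → Fin 3 → ℝ =>
        ((((‖Complex.exp (c w₀ 0 + c w₀ 2 * Complex.I) - Complex.exp (c w₀ 1 * Complex.I)‖ * ‖Complex.exp (-c w₀ 0 + c w₀ 2 * Complex.I) - Complex.exp (c w₀ 1 * Complex.I)‖ : ℝ) : ℂ) *
          ∏ w' ∈ Finset.univ.erase w₀,
            (if w' ∈ insert w₀ S then
                ((|Real.exp (c w' 0) - Real.exp (-c w' 0)| *
                  ‖Complex.exp (c w' 0 + c w' 2 * Complex.I) - Complex.exp (c w' 1 * Complex.I)‖ * ‖Complex.exp (-c w' 0 + c w' 2 * Complex.I) - Complex.exp (c w' 1 * Complex.I)‖ : ℝ) : ℂ)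
              else (1 - (Circle.exp (c w' 1 - c w' 0) : ℂ)) * (1 - (Circle.exp (c w' 2 - c w' 0) : ℂ)) * (1 - (Circle.exp (c w' 2 - c w' 1) : ℂ))))) *
        (K * G (B c, c w₀ 0, c w₀ 2)))
      (U ∩ InRegG (slotSign L α) (insert w₀ S)) := by
  -- the model is continuous on `U`
  have hBG : ContinuousOn (fun c : {w : InfinitePlace L // IsComplex w} → Fin 3 → ℝ => G (B c, c w₀ 0, c w₀ 2)) U :=
    hGc.comp_continuousOn (hB.prodMk (((continuous_apply 0).comp (continuous_apply w₀)).prodMk ((continuous_apply 2).comp (continuous_apply w₀))).continuousOn)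
  have hH : ContinuousOn (fun c : {w : InfinitePlace L // IsComplex w} → Fin 3 → ℝ =>
        ((((‖Complex.exp (c w₀ 0 + c w₀ 2 * Complex.I) - Complex.exp (c w₀ 1 * Complex.I)‖ * ‖Complex.exp (-c w₀ 0 + c w₀ 2 * Complex.I) - Complex.exp (c w₀ 1 * Complex.I)‖ : ℝ) : ℂ) *
          ∏ w' ∈ Finset.univ.erase w₀,
            (if w' ∈ insert w₀ S then
                ((|Real.exp (c w' 0) - Real.exp (-c w' 0)| *
                  ‖Complex.exp (c w' 0 + c w' 2 * Complex.I) - Complex.exp (c w' 1 * Complex.I)‖ * ‖Complex.exp (-c w' 0 + c w' 2 * Complex.I) - Complex.exp (c w' 1 * Complex.I)‖ : ℝ) : ℂ)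
              else (1 - (Circle.exp (c w' 1 - c w' 0) : ℂ)) * (1 - (Circle.exp (c w' 2 - c w' 0) : ℂ)) * (1 - (Circle.exp (c w' 2 - c w' 1) : ℂ))))) *
        (K * G (B c, c w₀ 0, c w₀ 2))) U :=
    (continuous_splitCofactor S w₀).continuousOn.mul (continuousOn_const.mul hBG)
  -- the raw member agrees with the model on `U ∩ RegG`
  refine hcExtendG_eqOn_of_continuousOn (slotSign L α) (insert w₀ S) (orbFamG L α ν' a' (insert w₀ S)) hU hH fun c hc => ?_
  rw [orbFamG_insert_eq_splitCofactor_mul L α ν' a' S w₀ hS' c, hdesc c hc, ← hG c hc, Complex.real_smul]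
  ring

/-- **THE SAME, WITH THE SMOOTH TOKEN SUPPLIED** (road (α)'s reading `B c := update c w₀ (0, c_{w₀,1}, 0)`, `Q := ` the coordinate space): for `μ₀′ ≠ 0` invariant Radon on
`U(J)⧸A`, `f` smooth with uniform compact `X`-support and the split-side descent identity on `U ∩ RegG (S ∪ {w₀})`, there is a jointly SMOOTH `G` on `Q × ℝ × ℝ` with
`G (q, x, θ) = |eˣ − e⁻ˣ| • ∫_{U(J)⧸A} f_q(↑↑(y a_{x,θ} y⁻¹)) dμ₀′` for `x ≠ 0` (§1) and **`orbFamGExt ν′ a′ (S ∪ {w₀}) = cof · (K · G (B ·, x, θ))` on `U ∩ InRegG (slotSign L α) (S ∪ {w₀})`**.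
[cite: Varadarajan1989, §6.4 Thm 23] [cite: Rogawski1990, §8.2 pp. 118–119] [cite: Shelstad1979, §4 Lemma 4.3 (p. 25), Prop. 4.5 (p. 26)] [cite: Bouaziz1994IntegralesOrbitales, §3.2 (I₃) p. 580] -/
theorem exists_contDiff_orbFamGExt_eqOn_of_splitDescent (hS' : ∀ w', w' ∈ insert w₀ S → w' ∈ splitChartPlaces L α)
    [SMulInvariantMeasure ↥(unitaryGroupOfForm (starRingEnd ℂ) J) (↥(unitaryGroupOfForm (starRingEnd ℂ) J) ⧸ torusU (starRingEnd ℂ) J) μ₀'] [IsFiniteMeasureOnCompacts μ₀'] (hμ : μ₀' ≠ 0)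
    {U : Set ({w : InfinitePlace L // IsComplex w} → Fin 3 → ℝ)} (hU : IsOpen U)
    {K : ℂ} {f : ({w : InfinitePlace L // IsComplex w} → Fin 3 → ℝ) × Matrix (Fin 2) (Fin 2) ℂ → ℂ} (hf : ContDiff ℝ ∞ f)
    {C : Set (Matrix (Fin 2) (Fin 2) ℂ)} (hC : IsCompact C) (hfC : ∀ q X, X ∉ C → f (q, X) = 0)
    (hdesc : ∀ c ∈ U ∩ RegG (insert w₀ S), chartOrbG L α ν' (insert w₀ S) a' c =
      K * ∫ y, descConj (⟨hypBlockGL (c w₀ 0) (c w₀ 2), hypBlockGL_mem_of_eq_over hJ (c w₀ 0) (c w₀ 2)⟩ : ↥(unitaryGroupOfForm (starRingEnd ℂ) J)) (torusU (starRingEnd ℂ) J)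
        (LineRing.forall_mem_torusU_comm (starRingEnd ℂ) J (hypBlockGL_mem_torusU hJ (c w₀ 0) (c w₀ 2)))
        (fun h : ↥(unitaryGroupOfForm (starRingEnd ℂ) J) => f (Function.update c w₀ ![0, c w₀ 1, 0], ((h : GL (Fin 2) ℂ) : Matrix (Fin 2) (Fin 2) ℂ))) y ∂μ₀') :
    ∃ G : (({w : InfinitePlace L // IsComplex w} → Fin 3 → ℝ) × ℝ × ℝ) → ℂ, ContDiff ℝ ∞ G ∧
      (∀ (q : {w : InfinitePlace L // IsComplex w} → Fin 3 → ℝ) (x θ : ℝ), x ≠ 0 →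
        |Real.exp x - Real.exp (-x)| •
          ∫ y, descConj (⟨hypBlockGL x θ, hypBlockGL_mem_of_eq_over hJ x θ⟩ : ↥(unitaryGroupOfForm (starRingEnd ℂ) J)) (torusU (starRingEnd ℂ) J)
            (LineRing.forall_mem_torusU_comm (starRingEnd ℂ) J (hypBlockGL_mem_torusU hJ x θ))
            (fun h : ↥(unitaryGroupOfForm (starRingEnd ℂ) J) => f (q, ((h : GL (Fin 2) ℂ) : Matrix (Fin 2) (Fin 2) ℂ))) y ∂μ₀' = G (q, x, θ)) ∧
      EqOn (orbFamGExt L α ν' a' (insert w₀ S))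
        (fun c : {w : InfinitePlace L // IsComplex w} → Fin 3 → ℝ =>
          ((((‖Complex.exp (c w₀ 0 + c w₀ 2 * Complex.I) - Complex.exp (c w₀ 1 * Complex.I)‖ * ‖Complex.exp (-c w₀ 0 + c w₀ 2 * Complex.I) - Complex.exp (c w₀ 1 * Complex.I)‖ : ℝ) : ℂ) *
            ∏ w' ∈ Finset.univ.erase w₀,
              (if w' ∈ insert w₀ S then
                  ((|Real.exp (c w' 0) - Real.exp (-c w' 0)| *
                    ‖Complex.exp (c w' 0 + c w' 2 * Complex.I) - Complex.exp (c w' 1 * Complex.I)‖ * ‖Complex.exp (-c w' 0 + c w' 2 * Complex.I) - Complex.exp (c w' 1 * Complex.I)‖ : ℝ) : ℂ)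
                else (1 - (Circle.exp (c w' 1 - c w' 0) : ℂ)) * (1 - (Circle.exp (c w' 2 - c w' 0) : ℂ)) * (1 - (Circle.exp (c w' 2 - c w' 1) : ℂ))))) *
          (K * G (Function.update c w₀ ![0, c w₀ 1, 0], c w₀ 0, c w₀ 2)))
        (U ∩ InRegG (slotSign L α) (insert w₀ S)) := by
  obtain ⟨G, hG, hGeq⟩ := exists_contDiff_absSub_smul_integral_descConj_hypBlockGL_eq_of_ne_zero hJ μ₀' hμ f hf hC hfC
  have hB : Continuous fun c : {w : InfinitePlace L // IsComplex w} → Fin 3 → ℝ => Function.update c w₀ ![0, c w₀ 1, 0] := by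
    exact continuous_id.update w₀
      (continuous_const.matrixVecCons (((continuous_apply 1).comp (continuous_apply w₀)).matrixVecCons (continuous_const.matrixVecCons continuous_const)))
  refine ⟨G, hG, hGeq, orbFamGExt_eqOn_cofactor_mul_of_splitDescent L α ν' a' S w₀ hJ μ₀' hS' hU hB.continuousOn hdesc hG.continuous fun c hc => ?_⟩
  exact hGeq _ _ _ (hc.2.2 w₀ (Finset.mem_insert_self w₀ S))

/-! ## §3 The `x`-ray form (SPEC-I3 v1.1 §5 (B-desc-hyp)) -/

/-- **THE `x`-RAY FORM THROUGH THE CAYLEY POINT** (SPEC-I3 v1.1 §5 (B-desc-hyp), up to the wall-factor bookkeeping `e^{ρ}·cof = R♯` of LH1-p03's (R•) files): at a semiregular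
wall point `p` of `(w₀, 0, 2)` (`S` admissible, `w₀` a split-chart place), given road (α)'s split-side descent identity on an open `U ∋ hcCayPt w₀ 0 2 p` with a smooth, uniformly compactly
supported block function `f` and `μ₀′ ≠ 0` invariant Radon, there are the jointly smooth token `G` of §1 and `δ > 0` with, for ALL `|x| < δ` (the wall `x = 0` included),
**`orbFamGExt ν′ a′ (S ∪ {w₀}) (hcCayPt w₀ 0 2 p + x • e_{w₀,0}) = cof(hcCayPt w₀ 0 2 p + x • e_{w₀,0}) · (K · G (update p w₀ (0, p_{w₀,1}, 0), x, p_{w₀,0}))`** — the base point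
`π p = update p w₀ (0, p_{w₀,1}, 0)` and the phase `θ = p_{w₀,0}` are CONSTANT along the ray. [cite: Shelstad1979, §4 Lemma 4.3 (p. 25), Prop. 4.5 (p. 26)]
[cite: Varadarajan1989, §6.4 Thm 23] [cite: Rogawski1990, §8.2 p. 119] [cite: Bouaziz1994IntegralesOrbitales, §3.2 (I₃) p. 580] -/
theorem exists_contDiff_orbFamGExt_cayRay_eq_of_splitDescent (hS : ∀ w, w ∈ S → w ∈ splitChartPlaces L α) (hsp : w₀ ∈ splitChartPlaces L α)
    {p : {w : InfinitePlace L // IsComplex w} → Fin 3 → ℝ} (hp : HcSemireg S w₀ 0 2 p)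
    [SMulInvariantMeasure ↥(unitaryGroupOfForm (starRingEnd ℂ) J) (↥(unitaryGroupOfForm (starRingEnd ℂ) J) ⧸ torusU (starRingEnd ℂ) J) μ₀'] [IsFiniteMeasureOnCompacts μ₀'] (hμ : μ₀' ≠ 0)
    {U : Set ({w : InfinitePlace L // IsComplex w} → Fin 3 → ℝ)} (hU : IsOpen U) (hpU : hcCayPt w₀ 0 2 p ∈ U)
    {K : ℂ} {f : ({w : InfinitePlace L // IsComplex w} → Fin 3 → ℝ) × Matrix (Fin 2) (Fin 2) ℂ → ℂ} (hf : ContDiff ℝ ∞ f)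
    {C : Set (Matrix (Fin 2) (Fin 2) ℂ)} (hC : IsCompact C) (hfC : ∀ q X, X ∉ C → f (q, X) = 0)
    (hdesc : ∀ c ∈ U ∩ RegG (insert w₀ S), chartOrbG L α ν' (insert w₀ S) a' c =
      K * ∫ y, descConj (⟨hypBlockGL (c w₀ 0) (c w₀ 2), hypBlockGL_mem_of_eq_over hJ (c w₀ 0) (c w₀ 2)⟩ : ↥(unitaryGroupOfForm (starRingEnd ℂ) J)) (torusU (starRingEnd ℂ) J)
        (LineRing.forall_mem_torusU_comm (starRingEnd ℂ) J (hypBlockGL_mem_torusU hJ (c w₀ 0) (c w₀ 2)))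
        (fun h : ↥(unitaryGroupOfForm (starRingEnd ℂ) J) => f (Function.update c w₀ ![0, c w₀ 1, 0], ((h : GL (Fin 2) ℂ) : Matrix (Fin 2) (Fin 2) ℂ))) y ∂μ₀') :
    ∃ G : (({w : InfinitePlace L // IsComplex w} → Fin 3 → ℝ) × ℝ × ℝ) → ℂ, ContDiff ℝ ∞ G ∧
      (∀ (q : {w : InfinitePlace L // IsComplex w} → Fin 3 → ℝ) (x θ : ℝ), x ≠ 0 →
        |Real.exp x - Real.exp (-x)| •
          ∫ y, descConj (⟨hypBlockGL x θ, hypBlockGL_mem_of_eq_over hJ x θ⟩ : ↥(unitaryGroupOfForm (starRingEnd ℂ) J)) (torusU (starRingEnd ℂ) J)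
            (LineRing.forall_mem_torusU_comm (starRingEnd ℂ) J (hypBlockGL_mem_torusU hJ x θ))
            (fun h : ↥(unitaryGroupOfForm (starRingEnd ℂ) J) => f (q, ((h : GL (Fin 2) ℂ) : Matrix (Fin 2) (Fin 2) ℂ))) y ∂μ₀' = G (q, x, θ)) ∧
      ∃ δ > (0 : ℝ), ∀ x : ℝ, |x| < δ →
        orbFamGExt L α ν' a' (insert w₀ S) (hcCayPt w₀ 0 2 p + x • (Pi.single w₀ (Pi.single 0 1 : Fin 3 → ℝ) : {w : InfinitePlace L // IsComplex w} → Fin 3 → ℝ)) =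
          ((((‖Complex.exp ((hcCayPt w₀ 0 2 p + x • (Pi.single w₀ (Pi.single 0 1 : Fin 3 → ℝ) : {w : InfinitePlace L // IsComplex w} → Fin 3 → ℝ)) w₀ 0 +
                    (hcCayPt w₀ 0 2 p + x • (Pi.single w₀ (Pi.single 0 1 : Fin 3 → ℝ) : {w : InfinitePlace L // IsComplex w} → Fin 3 → ℝ)) w₀ 2 * Complex.I) -
                  Complex.exp ((hcCayPt w₀ 0 2 p + x • (Pi.single w₀ (Pi.single 0 1 : Fin 3 → ℝ) : {w : InfinitePlace L // IsComplex w} → Fin 3 → ℝ)) w₀ 1 * Complex.I)‖ *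
              ‖Complex.exp (-(hcCayPt w₀ 0 2 p + x • (Pi.single w₀ (Pi.single 0 1 : Fin 3 → ℝ) : {w : InfinitePlace L // IsComplex w} → Fin 3 → ℝ)) w₀ 0 +
                    (hcCayPt w₀ 0 2 p + x • (Pi.single w₀ (Pi.single 0 1 : Fin 3 → ℝ) : {w : InfinitePlace L // IsComplex w} → Fin 3 → ℝ)) w₀ 2 * Complex.I) -
                  Complex.exp ((hcCayPt w₀ 0 2 p + x • (Pi.single w₀ (Pi.single 0 1 : Fin 3 → ℝ) : {w : InfinitePlace L // IsComplex w} → Fin 3 → ℝ)) w₀ 1 * Complex.I)‖ : ℝ) : ℂ) *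
            ∏ w' ∈ Finset.univ.erase w₀,
              (if w' ∈ insert w₀ S then
                  ((|Real.exp ((hcCayPt w₀ 0 2 p + x • (Pi.single w₀ (Pi.single 0 1 : Fin 3 → ℝ) : {w : InfinitePlace L // IsComplex w} → Fin 3 → ℝ)) w' 0) -
                      Real.exp (-(hcCayPt w₀ 0 2 p + x • (Pi.single w₀ (Pi.single 0 1 : Fin 3 → ℝ) : {w : InfinitePlace L // IsComplex w} → Fin 3 → ℝ)) w' 0)| *
                    ‖Complex.exp ((hcCayPt w₀ 0 2 p + x • (Pi.single w₀ (Pi.single 0 1 : Fin 3 → ℝ) : {w : InfinitePlace L // IsComplex w} → Fin 3 → ℝ)) w' 0 +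
                          (hcCayPt w₀ 0 2 p + x • (Pi.single w₀ (Pi.single 0 1 : Fin 3 → ℝ) : {w : InfinitePlace L // IsComplex w} → Fin 3 → ℝ)) w' 2 * Complex.I) -
                        Complex.exp ((hcCayPt w₀ 0 2 p + x • (Pi.single w₀ (Pi.single 0 1 : Fin 3 → ℝ) : {w : InfinitePlace L // IsComplex w} → Fin 3 → ℝ)) w' 1 * Complex.I)‖ *
                    ‖Complex.exp (-(hcCayPt w₀ 0 2 p + x • (Pi.single w₀ (Pi.single 0 1 : Fin 3 → ℝ) : {w : InfinitePlace L // IsComplex w} → Fin 3 → ℝ)) w' 0 +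
                          (hcCayPt w₀ 0 2 p + x • (Pi.single w₀ (Pi.single 0 1 : Fin 3 → ℝ) : {w : InfinitePlace L // IsComplex w} → Fin 3 → ℝ)) w' 2 * Complex.I) -
                        Complex.exp ((hcCayPt w₀ 0 2 p + x • (Pi.single w₀ (Pi.single 0 1 : Fin 3 → ℝ) : {w : InfinitePlace L // IsComplex w} → Fin 3 → ℝ)) w' 1 * Complex.I)‖ : ℝ) : ℂ)
                else
                  (1 - (Circle.exp ((hcCayPt w₀ 0 2 p + x • (Pi.single w₀ (Pi.single 0 1 : Fin 3 → ℝ) : {w : InfinitePlace L // IsComplex w} → Fin 3 → ℝ)) w' 1 -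
                        (hcCayPt w₀ 0 2 p + x • (Pi.single w₀ (Pi.single 0 1 : Fin 3 → ℝ) : {w : InfinitePlace L // IsComplex w} → Fin 3 → ℝ)) w' 0) : ℂ)) *
                    (1 - (Circle.exp ((hcCayPt w₀ 0 2 p + x • (Pi.single w₀ (Pi.single 0 1 : Fin 3 → ℝ) : {w : InfinitePlace L // IsComplex w} → Fin 3 → ℝ)) w' 2 -
                        (hcCayPt w₀ 0 2 p + x • (Pi.single w₀ (Pi.single 0 1 : Fin 3 → ℝ) : {w : InfinitePlace L // IsComplex w} → Fin 3 → ℝ)) w' 0) : ℂ)) *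
                    (1 - (Circle.exp ((hcCayPt w₀ 0 2 p + x • (Pi.single w₀ (Pi.single 0 1 : Fin 3 → ℝ) : {w : InfinitePlace L // IsComplex w} → Fin 3 → ℝ)) w' 2 -
                        (hcCayPt w₀ 0 2 p + x • (Pi.single w₀ (Pi.single 0 1 : Fin 3 → ℝ) : {w : InfinitePlace L // IsComplex w} → Fin 3 → ℝ)) w' 1) : ℂ))))) *
            (K * G (Function.update p w₀ ![0, p w₀ 1, 0], x, p w₀ 0)) := by
  have hS' : ∀ w', w' ∈ insert w₀ S → w' ∈ splitChartPlaces L α := fun w hw =>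
    (Finset.mem_insert.1 hw).elim (fun h => h ▸ hsp) (hS w)
  obtain ⟨G, hG, hGeq, hEq⟩ := exists_contDiff_orbFamGExt_eqOn_of_splitDescent L α ν' a' S w₀ hJ μ₀' hS' hμ hU hf hC hfC hdesc
  refine ⟨G, hG, hGeq, ?_⟩
  -- the ray runs in `U` for small `|x|`
  have hray : ∀ᶠ x in 𝓝 (0 : ℝ), hcCayPt w₀ 0 2 p + x • (Pi.single w₀ (Pi.single 0 1 : Fin 3 → ℝ) : {w : InfinitePlace L // IsComplex w} → Fin 3 → ℝ) ∈ U :=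
    tendsto_cayRay p w₀ 0 2 (hU.mem_nhds hpU)
  obtain ⟨δ, hδ, hδU⟩ := Metric.eventually_nhds_iff.1 hray
  refine ⟨δ, hδ, fun x hx => ?_⟩
  have hxU : hcCayPt w₀ 0 2 p + x • (Pi.single w₀ (Pi.single 0 1 : Fin 3 → ℝ) : {w : InfinitePlace L // IsComplex w} → Fin 3 → ℝ) ∈ U :=
    hδU (by rwa [dist_zero_right, Real.norm_eq_abs])
  -- … and in `InRegG (slotSign L α) (S ∪ {w₀})` for every `x` (no condition at the split place `w₀`; `p` regular at the other compact places)
  have hxI : hcCayPt w₀ 0 2 p + x • (Pi.single w₀ (Pi.single 0 1 : Fin 3 → ℝ) : {w : InfinitePlace L // IsComplex w} → Fin 3 → ℝ) ∈ InRegG (slotSign L α) (insert w₀ S) := by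
    intro w hw i j hij _
    rw [Finset.mem_insert, not_or] at hw
    rw [cayRay_apply_of_ne p hw.1]
    exact fun h => hij (hp.2.2.1 w hw.2 hw.1 h)
  -- the base point and the phase are constant along the ray
  have hbase : Function.update (hcCayPt w₀ 0 2 p + x • (Pi.single w₀ (Pi.single 0 1 : Fin 3 → ℝ) : {w : InfinitePlace L // IsComplex w} → Fin 3 → ℝ)) w₀
        ![0, (hcCayPt w₀ 0 2 p + x • (Pi.single w₀ (Pi.single 0 1 : Fin 3 → ℝ) : {w : InfinitePlace L // IsComplex w} → Fin 3 → ℝ)) w₀ 1, 0] =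
      Function.update p w₀ ![0, p w₀ 1, 0] := by
    rw [cayRay_apply_self_one, hcThird_zero_two]
    funext w
    by_cases hw : w = w₀
    · rw [hw, Function.update_self, Function.update_self]
    · rw [Function.update_of_ne hw, Function.update_of_ne hw, cayRay_apply_of_ne p hw]
  have hx0 : (hcCayPt w₀ 0 2 p + x • (Pi.single w₀ (Pi.single 0 1 : Fin 3 → ℝ) : {w : InfinitePlace L // IsComplex w} → Fin 3 → ℝ)) w₀ 0 = x :=
    cayRay_apply_self_zero p w₀ 0 2 x
  have hθ : (hcCayPt w₀ 0 2 p + x • (Pi.single w₀ (Pi.single 0 1 : Fin 3 → ℝ) : {w : InfinitePlace L // IsComplex w} → Fin 3 → ℝ)) w₀ 2 = p w₀ 0 := by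
    rw [cayRay_apply_self_two, ← hp.1, add_self_div_two]
  have h := hEq ⟨hxU, hxI⟩
  dsimp only at h
  rw [h, hbase, hx0, hθ]

/-- **SPEC-I3 v1.1 §5 (B-desc-hyp), VERBATIM SHAPE: `e^{ρ}_{S∪w₀} · 'F_{S∪w₀}` ALONG THE `x`-RAY THROUGH THE CAYLEY POINT.**  Under the hypotheses of ★
`exists_contDiff_orbFamGExt_cayRay_eq_of_splitDescent` (road (α)'s split-side descent identity on an open `U ∋ hcCayPt w₀ 0 2 p`, `f` smooth with uniform compact support,
`μ₀′ ≠ 0` invariant Radon): with the smooth token `G` of §1 and some `δ > 0`, for ALL `|x| < δ`,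
**`archERhoG (S ∪ {w₀}) (cayRay x) · orbFamGExt ν′ a′ (S ∪ {w₀}) (cayRay x) = K · R♯ p x · G (update p w₀ (0, p_{w₀,1}, 0), x, p_{w₀,0})`**,
`R♯ p x = (‖e^{x + i p₀} − e^{i p₁}‖ · ‖e^{−x + i p₀} − e^{i p₁}‖) · Π p` the split wall factor of ★ LH1-p03 (`e^{ρ} · cof = R♯`, ★ `archERhoG_mul_splitCofactor_eq_splitWallFactorR`, no division
by `|eˣ − e⁻ˣ|`) — the `K″ · R″ p x · Λ f x` of the spec with `K″ := K`, `Λ f := G (π p, ·, p_{w₀,0})`. [cite: Shelstad1979, §4 Lemma 4.3 (p. 25), Prop. 4.5 (p. 26)]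
[cite: Varadarajan1989, §6.4 Thm 23] [cite: Rogawski1990, §8.2 p. 119] [cite: Bouaziz1994IntegralesOrbitales, §3.2 (I₃) p. 580] -/
theorem exists_contDiff_archERhoG_mul_orbFamGExt_cayRay_eq_of_splitDescent (hS : ∀ w, w ∈ S → w ∈ splitChartPlaces L α) (hsp : w₀ ∈ splitChartPlaces L α)
    {p : {w : InfinitePlace L // IsComplex w} → Fin 3 → ℝ} (hp : HcSemireg S w₀ 0 2 p)
    [SMulInvariantMeasure ↥(unitaryGroupOfForm (starRingEnd ℂ) J) (↥(unitaryGroupOfForm (starRingEnd ℂ) J) ⧸ torusU (starRingEnd ℂ) J) μ₀'] [IsFiniteMeasureOnCompacts μ₀'] (hμ : μ₀' ≠ 0)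
    {U : Set ({w : InfinitePlace L // IsComplex w} → Fin 3 → ℝ)} (hU : IsOpen U) (hpU : hcCayPt w₀ 0 2 p ∈ U)
    {K : ℂ} {f : ({w : InfinitePlace L // IsComplex w} → Fin 3 → ℝ) × Matrix (Fin 2) (Fin 2) ℂ → ℂ} (hf : ContDiff ℝ ∞ f)
    {C : Set (Matrix (Fin 2) (Fin 2) ℂ)} (hC : IsCompact C) (hfC : ∀ q X, X ∉ C → f (q, X) = 0)
    (hdesc : ∀ c ∈ U ∩ RegG (insert w₀ S), chartOrbG L α ν' (insert w₀ S) a' c =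
      K * ∫ y, descConj (⟨hypBlockGL (c w₀ 0) (c w₀ 2), hypBlockGL_mem_of_eq_over hJ (c w₀ 0) (c w₀ 2)⟩ : ↥(unitaryGroupOfForm (starRingEnd ℂ) J)) (torusU (starRingEnd ℂ) J)
        (LineRing.forall_mem_torusU_comm (starRingEnd ℂ) J (hypBlockGL_mem_torusU hJ (c w₀ 0) (c w₀ 2)))
        (fun h : ↥(unitaryGroupOfForm (starRingEnd ℂ) J) => f (Function.update c w₀ ![0, c w₀ 1, 0], ((h : GL (Fin 2) ℂ) : Matrix (Fin 2) (Fin 2) ℂ))) y ∂μ₀') :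
    ∃ G : (({w : InfinitePlace L // IsComplex w} → Fin 3 → ℝ) × ℝ × ℝ) → ℂ, ContDiff ℝ ∞ G ∧
      (∀ (q : {w : InfinitePlace L // IsComplex w} → Fin 3 → ℝ) (x θ : ℝ), x ≠ 0 →
        |Real.exp x - Real.exp (-x)| •
          ∫ y, descConj (⟨hypBlockGL x θ, hypBlockGL_mem_of_eq_over hJ x θ⟩ : ↥(unitaryGroupOfForm (starRingEnd ℂ) J)) (torusU (starRingEnd ℂ) J)
            (LineRing.forall_mem_torusU_comm (starRingEnd ℂ) J (hypBlockGL_mem_torusU hJ x θ))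
            (fun h : ↥(unitaryGroupOfForm (starRingEnd ℂ) J) => f (q, ((h : GL (Fin 2) ℂ) : Matrix (Fin 2) (Fin 2) ℂ))) y ∂μ₀' = G (q, x, θ)) ∧
      ∃ δ > (0 : ℝ), ∀ x : ℝ, |x| < δ →
        archERhoG (insert w₀ S) (hcCayPt w₀ 0 2 p + x • (Pi.single w₀ (Pi.single 0 1 : Fin 3 → ℝ) : {w : InfinitePlace L // IsComplex w} → Fin 3 → ℝ)) *
            orbFamGExt L α ν' a' (insert w₀ S) (hcCayPt w₀ 0 2 p + x • (Pi.single w₀ (Pi.single 0 1 : Fin 3 → ℝ) : {w : InfinitePlace L // IsComplex w} → Fin 3 → ℝ)) =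
          K * (((‖Complex.exp (x + p w₀ 0 * Complex.I) - Complex.exp (p w₀ 1 * Complex.I)‖ * ‖Complex.exp (-x + p w₀ 0 * Complex.I) - Complex.exp (p w₀ 1 * Complex.I)‖ : ℝ) : ℂ) *
            ∏ w' ∈ Finset.univ.erase w₀,
              ((if w' ∈ S then (1 : ℂ) else (Circle.exp (p w' 0 - p w' 2) : ℂ)) *
                (if w' ∈ S then
                    ((|Real.exp (p w' 0) - Real.exp (-p w' 0)| *
                      ‖Complex.exp (p w' 0 + p w' 2 * Complex.I) - Complex.exp (p w' 1 * Complex.I)‖ * ‖Complex.exp (-p w' 0 + p w' 2 * Complex.I) - Complex.exp (p w' 1 * Complex.I)‖ : ℝ) : ℂ)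
                  else (1 - (Circle.exp (p w' 1 - p w' 0) : ℂ)) * (1 - (Circle.exp (p w' 2 - p w' 0) : ℂ)) * (1 - (Circle.exp (p w' 2 - p w' 1) : ℂ))))) *
            G (Function.update p w₀ ![0, p w₀ 1, 0], x, p w₀ 0) := by
  obtain ⟨G, hG, hGeq, δ, hδ, hray⟩ :=
    exists_contDiff_orbFamGExt_cayRay_eq_of_splitDescent L α ν' a' S w₀ hJ μ₀' hS hsp hp hμ hU hpU hf hC hfC hdesc
  refine ⟨G, hG, hGeq, δ, hδ, fun x hx => ?_⟩
  have h0 : (hcCayPt w₀ 0 2 p + x • (Pi.single w₀ (Pi.single 0 1 : Fin 3 → ℝ) : {w : InfinitePlace L // IsComplex w} → Fin 3 → ℝ)) w₀ 0 = x :=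
    cayRay_apply_self_zero p w₀ 0 2 x
  have h1 : (hcCayPt w₀ 0 2 p + x • (Pi.single w₀ (Pi.single 0 1 : Fin 3 → ℝ) : {w : InfinitePlace L // IsComplex w} → Fin 3 → ℝ)) w₀ 1 = p w₀ 1 := by
    rw [cayRay_apply_self_one, hcThird_zero_two]
  have h2 : (hcCayPt w₀ 0 2 p + x • (Pi.single w₀ (Pi.single 0 1 : Fin 3 → ℝ) : {w : InfinitePlace L // IsComplex w} → Fin 3 → ℝ)) w₀ 2 = p w₀ 0 := by
    rw [cayRay_apply_self_two, ← hp.1, add_self_div_two]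
  rw [hray x hx, ← mul_assoc, ← mul_assoc,
    archERhoG_mul_splitCofactor_eq_splitWallFactorR S h0 h1 h2 (fun w' hw' => cayRay_apply_of_ne p hw' 0 2 x)]
  ring

end Dress

/-! ## §4 (B-desc-hyp) HYPOTHESIS-FREE: road (α) ★ p851074 instantiated — ONE `K`, ONE `f`, ONE smooth `G`, both charts, through the real wall -/

section TwoChart

variable (L : Type) [Field L] [NumberField L] [IsCMField L] (α : Fin 3 → L)
  [MeasurableSpace ↥(arch (↥(maximalRealSubfield L)) L (IsCMField.complexConj L) 3 (Matrix.diagonal α))]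
  [BorelSpace ↥(arch (↥(maximalRealSubfield L)) L (IsCMField.complexConj L) 3 (Matrix.diagonal α))]
  (ν' : Measure ↥(arch (↥(maximalRealSubfield L)) L (IsCMField.complexConj L) 3 (Matrix.diagonal α))) [ν'.IsHaarMeasure] [ν'.IsMulRightInvariant]
  (a' : ↥(arch (↥(maximalRealSubfield L)) L (IsCMField.complexConj L) 3 (Matrix.diagonal α)) → ℂ)
  (S : Finset {w : InfinitePlace L // IsComplex w}) (w₀ : {w : InfinitePlace L // IsComplex w})

/-- **BOOKKEEPING ON THE `x`-RAY**: if `orbFamGExt (S ∪ {w₀}) = cof · (K · G (update · w₀ (0, ·_{w₀,1}, 0), x, θ))` on `U ∩ InRegG` for an open `U ∋ hcCayPt w₀ 0 2 p`, `p` semiregular,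
then for `|x| < δ`: `e^{ρ}_{S∪w₀}(cayRay x) · orbFamGExt (S ∪ {w₀}) (cayRay x) = K · R♯ p x · G (update p w₀ (0, p_{w₀,1}, 0), x, p_{w₀,0})` (the ray stays in `U ∩ InRegG`; base point
and phase are constant along it; ★ `archERhoG_mul_splitCofactor_eq_splitWallFactorR`). [cite: Shelstad1979, §4 Lemma 4.3 (p. 25)] [cite: Rogawski1990, §8.2 p. 119] -/
theorem exists_pos_archERhoG_mul_orbFamGExt_cayRay_eq_of_eqOn {p : {w : InfinitePlace L // IsComplex w} → Fin 3 → ℝ} (hp : HcSemireg S w₀ 0 2 p)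
    {U : Set ({w : InfinitePlace L // IsComplex w} → Fin 3 → ℝ)} (hU : IsOpen U) (hpU : hcCayPt w₀ 0 2 p ∈ U) {K : ℂ}
    {G : (({w : InfinitePlace L // IsComplex w} → Fin 3 → ℝ) × ℝ × ℝ) → ℂ}
    (hEq : EqOn (orbFamGExt L α ν' a' (insert w₀ S))
      (fun c : {w : InfinitePlace L // IsComplex w} → Fin 3 → ℝ =>
        ((((‖Complex.exp (c w₀ 0 + c w₀ 2 * Complex.I) - Complex.exp (c w₀ 1 * Complex.I)‖ * ‖Complex.exp (-c w₀ 0 + c w₀ 2 * Complex.I) - Complex.exp (c w₀ 1 * Complex.I)‖ : ℝ) : ℂ) *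
          ∏ w' ∈ Finset.univ.erase w₀,
            (if w' ∈ insert w₀ S then
                ((|Real.exp (c w' 0) - Real.exp (-c w' 0)| *
                  ‖Complex.exp (c w' 0 + c w' 2 * Complex.I) - Complex.exp (c w' 1 * Complex.I)‖ * ‖Complex.exp (-c w' 0 + c w' 2 * Complex.I) - Complex.exp (c w' 1 * Complex.I)‖ : ℝ) : ℂ)
              else (1 - (Circle.exp (c w' 1 - c w' 0) : ℂ)) * (1 - (Circle.exp (c w' 2 - c w' 0) : ℂ)) * (1 - (Circle.exp (c w' 2 - c w' 1) : ℂ))))) *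
        (K * G (Function.update c w₀ ![0, c w₀ 1, 0], c w₀ 0, c w₀ 2)))
      (U ∩ InRegG (slotSign L α) (insert w₀ S))) :
    ∃ δ > (0 : ℝ), ∀ x : ℝ, |x| < δ →
      archERhoG (insert w₀ S) (hcCayPt w₀ 0 2 p + x • (Pi.single w₀ (Pi.single 0 1 : Fin 3 → ℝ) : {w : InfinitePlace L // IsComplex w} → Fin 3 → ℝ)) *
          orbFamGExt L α ν' a' (insert w₀ S) (hcCayPt w₀ 0 2 p + x • (Pi.single w₀ (Pi.single 0 1 : Fin 3 → ℝ) : {w : InfinitePlace L // IsComplex w} → Fin 3 → ℝ)) =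
        K * (((‖Complex.exp (x + p w₀ 0 * Complex.I) - Complex.exp (p w₀ 1 * Complex.I)‖ * ‖Complex.exp (-x + p w₀ 0 * Complex.I) - Complex.exp (p w₀ 1 * Complex.I)‖ : ℝ) : ℂ) *
          ∏ w' ∈ Finset.univ.erase w₀,
            ((if w' ∈ S then (1 : ℂ) else (Circle.exp (p w' 0 - p w' 2) : ℂ)) *
              (if w' ∈ S then
                  ((|Real.exp (p w' 0) - Real.exp (-p w' 0)| *
                    ‖Complex.exp (p w' 0 + p w' 2 * Complex.I) - Complex.exp (p w' 1 * Complex.I)‖ * ‖Complex.exp (-p w' 0 + p w' 2 * Complex.I) - Complex.exp (p w' 1 * Complex.I)‖ : ℝ) : ℂ)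
                else (1 - (Circle.exp (p w' 1 - p w' 0) : ℂ)) * (1 - (Circle.exp (p w' 2 - p w' 0) : ℂ)) * (1 - (Circle.exp (p w' 2 - p w' 1) : ℂ))))) *
          G (Function.update p w₀ ![0, p w₀ 1, 0], x, p w₀ 0) := by
  have hray : ∀ᶠ x in 𝓝 (0 : ℝ), hcCayPt w₀ 0 2 p + x • (Pi.single w₀ (Pi.single 0 1 : Fin 3 → ℝ) : {w : InfinitePlace L // IsComplex w} → Fin 3 → ℝ) ∈ U :=
    tendsto_cayRay p w₀ 0 2 (hU.mem_nhds hpU)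
  obtain ⟨δ, hδ, hδU⟩ := Metric.eventually_nhds_iff.1 hray
  refine ⟨δ, hδ, fun x hx => ?_⟩
  have hxU : hcCayPt w₀ 0 2 p + x • (Pi.single w₀ (Pi.single 0 1 : Fin 3 → ℝ) : {w : InfinitePlace L // IsComplex w} → Fin 3 → ℝ) ∈ U :=
    hδU (by rwa [dist_zero_right, Real.norm_eq_abs])
  have hxI : hcCayPt w₀ 0 2 p + x • (Pi.single w₀ (Pi.single 0 1 : Fin 3 → ℝ) : {w : InfinitePlace L // IsComplex w} → Fin 3 → ℝ) ∈ InRegG (slotSign L α) (insert w₀ S) := by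
    intro w hw i j hij _
    rw [Finset.mem_insert, not_or] at hw
    rw [cayRay_apply_of_ne p hw.1]
    exact fun h => hij (hp.2.2.1 w hw.2 hw.1 h)
  have hbase : Function.update (hcCayPt w₀ 0 2 p + x • (Pi.single w₀ (Pi.single 0 1 : Fin 3 → ℝ) : {w : InfinitePlace L // IsComplex w} → Fin 3 → ℝ)) w₀
        ![0, (hcCayPt w₀ 0 2 p + x • (Pi.single w₀ (Pi.single 0 1 : Fin 3 → ℝ) : {w : InfinitePlace L // IsComplex w} → Fin 3 → ℝ)) w₀ 1, 0] =
      Function.update p w₀ ![0, p w₀ 1, 0] := by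
    rw [cayRay_apply_self_one, hcThird_zero_two]
    funext w
    by_cases hw : w = w₀
    · rw [hw, Function.update_self, Function.update_self]
    · rw [Function.update_of_ne hw, Function.update_of_ne hw, cayRay_apply_of_ne p hw]
  have h0 : (hcCayPt w₀ 0 2 p + x • (Pi.single w₀ (Pi.single 0 1 : Fin 3 → ℝ) : {w : InfinitePlace L // IsComplex w} → Fin 3 → ℝ)) w₀ 0 = x :=
    cayRay_apply_self_zero p w₀ 0 2 x
  have h1 : (hcCayPt w₀ 0 2 p + x • (Pi.single w₀ (Pi.single 0 1 : Fin 3 → ℝ) : {w : InfinitePlace L // IsComplex w} → Fin 3 → ℝ)) w₀ 1 = p w₀ 1 := by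
    rw [cayRay_apply_self_one, hcThird_zero_two]
  have h2 : (hcCayPt w₀ 0 2 p + x • (Pi.single w₀ (Pi.single 0 1 : Fin 3 → ℝ) : {w : InfinitePlace L // IsComplex w} → Fin 3 → ℝ)) w₀ 2 = p w₀ 0 := by
    rw [cayRay_apply_self_two, ← hp.1, add_self_div_two]
  have h := hEq ⟨hxU, hxI⟩
  dsimp only at h
  rw [h, hbase, ← mul_assoc, ← mul_assoc,
    archERhoG_mul_splitCofactor_eq_splitWallFactorR S h0 h1 h2 (fun w' hw' => cayRay_apply_of_ne p hw' 0 2 x), h0, h2]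
  ring

/-- **(B-desc-hyp) — HYPOTHESIS-FREE, BOTH CHARTS, THROUGH THE REAL WALL (SPEC-I3 v1.1 §5).**  House frame (`hα`, `hreal`), admissible compact chart `S`, covered split-chart
place `w₀ ∉ S`, semiregular point `p` of the wall `(w₀, 0, 2)`, `a′ ∈ C_c^∞(G′_∞)`, and the SHARED rank-one datum `(μ₀, μ₀′)` on `U(J)`, `U(J) ⧸ A_J` linked through every
inversion-invariant Haar measure of the split torus (`hlink`, cert. (v34b) text).  Then there are ONE constant `K ≠ 0`, open boxes `U ∋ p`, `U″ ∋ hcCayPt w₀ 0 2 p`, ONE jointly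
smooth block function `f` (uniform compact matrix support, tangential dependence) and ONE jointly smooth split token `G` such that: (i) road (α)'s two descent identities hold
(★ `exists_descent_twoChart_chartOrbG`, re-exported VERBATIM: the compact chart against `μ₀` on `U ∩ RegG S`, the Cayley chart against `μ₀′` on `U″` off the wall);
(ii) `G (q, x, θ) = |eˣ − e⁻ˣ| • ∫_{U(J)⧸A} f_q(↑↑(y a_{x,θ} y⁻¹)) dμ₀′` for `x ≠ 0` (§1); (iii) **`orbFamGExt ν′ a′ (S ∪ {w₀}) = cof · (K · G (update · w₀ (0, ·_{w₀,1}, 0), x, θ))` on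
`U″ ∩ InRegG (slotSign L α) (S ∪ {w₀})`**, the real wall included (§2); (iv) on the `x`-ray, for `|x| < δ`: **`e^{ρ}_{S∪w₀} · orbFamGExt ν′ a′ (S ∪ {w₀}) (cayRay x) = K · R♯ p x ·
G (update p w₀ (0, p_{w₀,1}, 0), x, p_{w₀,0})`** (§3∕★ (R4)).  With road (α)'s compact-chart identity this is the COMPLETE two-chart input of the (I₃) jump assembly ((B-norm), (B-trans),
(B-asm)): the SAME `f` is read by the elliptic functional on the normal line and by the split token on the Cayley ray. [cite: Shelstad1979, §4 Lemma 4.3 (p. 25), Prop. 4.5 (p. 26)]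
[cite: Varadarajan1989, §6.4 Thm 23] [cite: Rogawski1990, §8.2 pp. 119–124; §4.12 Lemma 4.12.1 p. 66] [cite: Bouaziz1994IntegralesOrbitales, §3.2 (I₃) p. 580] [cite: HarishChandra1970, Part I §3 Lemma 22] -/
theorem exists_twoChart_descent_orbFamGExt_realWall (hα : ∀ i, α i ≠ 0)
    (hreal : ∀ (w : {w : InfinitePlace L // IsComplex w}) (i : Fin 3), (w.1.embedding (α i)).im = 0)
    {J : Matrix (Fin 2) (Fin 2) ℂ} (hJ : J = (StdForm.antidiagonal 2).over ℂ)
    [MeasurableSpace ↥(unitaryGroupOfForm (starRingEnd ℂ) J)] [BorelSpace ↥(unitaryGroupOfForm (starRingEnd ℂ) J)]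
    [LocallyCompactSpace ↥(unitaryGroupOfForm (starRingEnd ℂ) J)] [SecondCountableTopology ↥(unitaryGroupOfForm (starRingEnd ℂ) J)]
    (μ₀ : Measure ↥(unitaryGroupOfForm (starRingEnd ℂ) J)) [μ₀.IsHaarMeasure] [μ₀.IsMulRightInvariant]
    [MeasurableSpace (↥(unitaryGroupOfForm (starRingEnd ℂ) J) ⧸ torusU (starRingEnd ℂ) J)] [BorelSpace (↥(unitaryGroupOfForm (starRingEnd ℂ) J) ⧸ torusU (starRingEnd ℂ) J)]
    (μ₀' : Measure (↥(unitaryGroupOfForm (starRingEnd ℂ) J) ⧸ torusU (starRingEnd ℂ) J))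
    [SMulInvariantMeasure ↥(unitaryGroupOfForm (starRingEnd ℂ) J) (↥(unitaryGroupOfForm (starRingEnd ℂ) J) ⧸ torusU (starRingEnd ℂ) J) μ₀'] [IsFiniteMeasureOnCompacts μ₀']
    (hlink : ∀ (ρ : Measure ↥(torusU (starRingEnd ℂ) J)) [ρ.IsHaarMeasure] [ρ.IsInvInvariant],
      μ₀' = ρ ((fun q : ℝ × ℝ =>
        (⟨⟨hypBlockGL q.1 q.2, hypBlockGL_mem_of_eq_over hJ q.1 q.2⟩, hypBlockGL_mem_torusU hJ q.1 q.2⟩ : ↥(torusU (starRingEnd ℂ) J))) ''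
          (Set.Icc (0 : ℝ) 1 ×ˢ Set.Icc (0 : ℝ) (2 * Real.pi))) •
        quotientMeasure (torusU (starRingEnd ℂ) J) ρ (LineRing.isClosed_torusU_two (starRingEnd ℂ) J) μ₀)
    {S : Finset {w : InfinitePlace L // IsComplex w}} {w₀ : {w : InfinitePlace L // IsComplex w}} {p : {w : InfinitePlace L // IsComplex w} → Fin 3 → ℝ}
    (hS : ∀ w, w ∈ S → w ∈ splitChartPlaces L α) (hw₀ : w₀ ∉ S) (hwsp : w₀ ∈ splitChartPlaces L α) (hp : HcSemireg S w₀ 0 2 p)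
    {a' : ↥(arch (↥(maximalRealSubfield L)) L (IsCMField.complexConj L) 3 (Matrix.diagonal α)) → ℂ} (ha' : ArchSmooth L 3 (Matrix.diagonal α) a') :
    ∃ (K : ℂ) (U U'' : Set ({w : InfinitePlace L // IsComplex w} → Fin 3 → ℝ)) (f : ({w : InfinitePlace L // IsComplex w} → Fin 3 → ℝ) × Matrix (Fin 2) (Fin 2) ℂ → ℂ)
      (G : (({w : InfinitePlace L // IsComplex w} → Fin 3 → ℝ) × ℝ × ℝ) → ℂ),
      K ≠ 0 ∧ IsOpen U ∧ p ∈ U ∧ IsOpen U'' ∧ hcCayPt w₀ 0 2 p ∈ U'' ∧ (∀ c ∈ U'', c w₀ 0 ≠ 0 → c ∈ RegG (insert w₀ S)) ∧ ContDiff ℝ ∞ f ∧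
      (∃ C : Set (Matrix (Fin 2) (Fin 2) ℂ), IsCompact C ∧ ∀ c X, X ∉ C → f (c, X) = 0) ∧
      (∀ c X, f (c, X) = f (Function.update c w₀ ![0, c w₀ 1, 0], X)) ∧
      (∀ c ∈ U ∩ RegG S, chartOrbG L α ν' S a' c =
        K * ∫ h : ↥(unitaryGroupOfForm (starRingEnd ℂ) J),
          f (c, (((h * ⟨Matrix.GeneralLinearGroup.mkOfDetNeZero !![(1 : ℂ), 1; 1, -1] det_cayleyTwo_ne_zero *
                circleDiagonal 2 ![Circle.exp (c w₀ 0), Circle.exp (c w₀ 2)] *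
                (Matrix.GeneralLinearGroup.mkOfDetNeZero !![(1 : ℂ), 1; 1, -1] det_cayleyTwo_ne_zero)⁻¹,
              cayley_conj_circleDiagonal_mem_of_eq_over hJ _⟩ * h⁻¹ : ↥(unitaryGroupOfForm (starRingEnd ℂ) J)) : GL (Fin 2) ℂ) : Matrix (Fin 2) (Fin 2) ℂ)) ∂μ₀) ∧
      (∀ c ∈ U'', c w₀ 0 ≠ 0 → chartOrbG L α ν' (insert w₀ S) a' c =
        K * ∫ y, descConj ((⟨hypBlockGL (c w₀ 0) (c w₀ 2), hypBlockGL_mem_of_eq_over hJ (c w₀ 0) (c w₀ 2)⟩ : ↥(unitaryGroupOfForm (starRingEnd ℂ) J))) (torusU (starRingEnd ℂ) J)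
          (LineRing.forall_mem_torusU_comm (starRingEnd ℂ) J (hypBlockGL_mem_torusU hJ (c w₀ 0) (c w₀ 2)))
          (fun b : ↥(unitaryGroupOfForm (starRingEnd ℂ) J) => f (c, ((b : GL (Fin 2) ℂ) : Matrix (Fin 2) (Fin 2) ℂ))) y ∂μ₀') ∧
      ContDiff ℝ ∞ G ∧
      (∀ (q : {w : InfinitePlace L // IsComplex w} → Fin 3 → ℝ) (x θ : ℝ), x ≠ 0 →
        |Real.exp x - Real.exp (-x)| •
          ∫ y, descConj (⟨hypBlockGL x θ, hypBlockGL_mem_of_eq_over hJ x θ⟩ : ↥(unitaryGroupOfForm (starRingEnd ℂ) J)) (torusU (starRingEnd ℂ) J)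
            (LineRing.forall_mem_torusU_comm (starRingEnd ℂ) J (hypBlockGL_mem_torusU hJ x θ))
            (fun h : ↥(unitaryGroupOfForm (starRingEnd ℂ) J) => f (q, ((h : GL (Fin 2) ℂ) : Matrix (Fin 2) (Fin 2) ℂ))) y ∂μ₀' = G (q, x, θ)) ∧
      EqOn (orbFamGExt L α ν' a' (insert w₀ S))
        (fun c : {w : InfinitePlace L // IsComplex w} → Fin 3 → ℝ =>
          ((((‖Complex.exp (c w₀ 0 + c w₀ 2 * Complex.I) - Complex.exp (c w₀ 1 * Complex.I)‖ * ‖Complex.exp (-c w₀ 0 + c w₀ 2 * Complex.I) - Complex.exp (c w₀ 1 * Complex.I)‖ : ℝ) : ℂ) *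
            ∏ w' ∈ Finset.univ.erase w₀,
              (if w' ∈ insert w₀ S then
                  ((|Real.exp (c w' 0) - Real.exp (-c w' 0)| *
                    ‖Complex.exp (c w' 0 + c w' 2 * Complex.I) - Complex.exp (c w' 1 * Complex.I)‖ * ‖Complex.exp (-c w' 0 + c w' 2 * Complex.I) - Complex.exp (c w' 1 * Complex.I)‖ : ℝ) : ℂ)
                else (1 - (Circle.exp (c w' 1 - c w' 0) : ℂ)) * (1 - (Circle.exp (c w' 2 - c w' 0) : ℂ)) * (1 - (Circle.exp (c w' 2 - c w' 1) : ℂ))))) *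
          (K * G (Function.update c w₀ ![0, c w₀ 1, 0], c w₀ 0, c w₀ 2)))
        (U'' ∩ InRegG (slotSign L α) (insert w₀ S)) ∧
      ∃ δ > (0 : ℝ), ∀ x : ℝ, |x| < δ →
        archERhoG (insert w₀ S) (hcCayPt w₀ 0 2 p + x • (Pi.single w₀ (Pi.single 0 1 : Fin 3 → ℝ) : {w : InfinitePlace L // IsComplex w} → Fin 3 → ℝ)) *
            orbFamGExt L α ν' a' (insert w₀ S) (hcCayPt w₀ 0 2 p + x • (Pi.single w₀ (Pi.single 0 1 : Fin 3 → ℝ) : {w : InfinitePlace L // IsComplex w} → Fin 3 → ℝ)) =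
          K * (((‖Complex.exp (x + p w₀ 0 * Complex.I) - Complex.exp (p w₀ 1 * Complex.I)‖ * ‖Complex.exp (-x + p w₀ 0 * Complex.I) - Complex.exp (p w₀ 1 * Complex.I)‖ : ℝ) : ℂ) *
            ∏ w' ∈ Finset.univ.erase w₀,
              ((if w' ∈ S then (1 : ℂ) else (Circle.exp (p w' 0 - p w' 2) : ℂ)) *
                (if w' ∈ S then
                    ((|Real.exp (p w' 0) - Real.exp (-p w' 0)| *
                      ‖Complex.exp (p w' 0 + p w' 2 * Complex.I) - Complex.exp (p w' 1 * Complex.I)‖ * ‖Complex.exp (-p w' 0 + p w' 2 * Complex.I) - Complex.exp (p w' 1 * Complex.I)‖ : ℝ) : ℂ)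
                  else (1 - (Circle.exp (p w' 1 - p w' 0) : ℂ)) * (1 - (Circle.exp (p w' 2 - p w' 0) : ℂ)) * (1 - (Circle.exp (p w' 2 - p w' 1) : ℂ))))) *
            G (Function.update p w₀ ![0, p w₀ 1, 0], x, p w₀ 0)  := by
  have hS' : ∀ w', w' ∈ insert w₀ S → w' ∈ splitChartPlaces L α := fun w hw =>
    (Finset.mem_insert.1 hw).elim (fun h => h ▸ hwsp) (hS w)
  -- `μ₀′ ≠ 0` from the link (the standard box of the split torus has positive Haar mass)
  have hμ : μ₀' ≠ 0 := by
    have hTUc : IsClosed ((torusU (starRingEnd ℂ) J : Subgroup ↥(unitaryGroupOfForm (starRingEnd ℂ) J)) : Set ↥(unitaryGroupOfForm (starRingEnd ℂ) J)) :=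
      LineRing.isClosed_torusU_two _ _
    haveI : LocallyCompactSpace ↥(torusU (starRingEnd ℂ) J) := hTUc.isClosedEmbedding_subtypeVal.locallyCompactSpace
    haveI : SecondCountableTopology ↥(torusU (starRingEnd ℂ) J) := TopologicalSpace.Subtype.secondCountableTopology _
    haveI : BorelSpace ↥(torusU (starRingEnd ℂ) J) := Subtype.borelSpace _
    obtain ⟨σ, hσ⟩ : ∃ σ : Measure ↥(torusU (starRingEnd ℂ) J), σ.IsHaarMeasure := ⟨Measure.haar, inferInstance⟩
    haveI := hσ
    haveI : σ.IsInvInvariant := isInvInvariant_of_comm _ hTUc (fun x hx y hy => LineRing.forall_mem_torusU_comm (starRingEnd ℂ) J hy x hx) σ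
    intro h0
    have h := hlink σ
    rw [h0] at h
    have hu := congrArg (fun m : Measure (↥(unitaryGroupOfForm (starRingEnd ℂ) J) ⧸ torusU (starRingEnd ℂ) J) => m Set.univ) h
    simp only [Measure.coe_zero, Pi.zero_apply, Measure.smul_apply, smul_eq_mul] at hu
    exact quotientMeasure_ne_zero (torusU (starRingEnd ℂ) J) σ (LineRing.isClosed_torusU_two (starRingEnd ℂ) J) μ₀
      (Measure.measure_univ_eq_zero.1 ((mul_eq_zero.1 hu.symm).resolve_left (measure_boxStd_ne_zero hJ σ)))
  -- ★ road (α)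
  obtain ⟨K, U, U'', f, hK, hU, hpU, hU'', hpU'', hreg, hf, ⟨C, hC, hfC⟩, htan, hcpt, hsplit⟩ :=
    exists_descent_twoChart_chartOrbG L α ν' hα hreal hJ μ₀ μ₀' hlink hS hw₀ hwsp hp ha'
  -- the split identity in the tangential reading, on `U″ ∩ RegG (S ∪ {w₀})`
  have hdesc : ∀ c ∈ U'' ∩ RegG (insert w₀ S), chartOrbG L α ν' (insert w₀ S) a' c =
      K * ∫ y, descConj (⟨hypBlockGL (c w₀ 0) (c w₀ 2), hypBlockGL_mem_of_eq_over hJ (c w₀ 0) (c w₀ 2)⟩ : ↥(unitaryGroupOfForm (starRingEnd ℂ) J)) (torusU (starRingEnd ℂ) J)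
        (LineRing.forall_mem_torusU_comm (starRingEnd ℂ) J (hypBlockGL_mem_torusU hJ (c w₀ 0) (c w₀ 2)))
        (fun h : ↥(unitaryGroupOfForm (starRingEnd ℂ) J) => f (Function.update c w₀ ![0, c w₀ 1, 0], ((h : GL (Fin 2) ℂ) : Matrix (Fin 2) (Fin 2) ℂ))) y ∂μ₀' := by
    intro c hc
    have hF : (fun h : ↥(unitaryGroupOfForm (starRingEnd ℂ) J) => f (Function.update c w₀ ![0, c w₀ 1, 0], ((h : GL (Fin 2) ℂ) : Matrix (Fin 2) (Fin 2) ℂ))) =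
        fun h : ↥(unitaryGroupOfForm (starRingEnd ℂ) J) => f (c, ((h : GL (Fin 2) ℂ) : Matrix (Fin 2) (Fin 2) ℂ)) :=
      funext fun h => (htan c _).symm
    rw [hF]
    exact hsplit c hc.1 (hc.2.2 w₀ (Finset.mem_insert_self w₀ S))
  obtain ⟨G, hG, hGeq, hEqOn⟩ := exists_contDiff_orbFamGExt_eqOn_of_splitDescent L α ν' a' S w₀ hJ μ₀' hS' hμ hU'' hf hC hfC hdesc
  exact ⟨K, U, U'', f, G, hK, hU, hpU, hU'', hpU'', hreg, hf, ⟨C, hC, hfC⟩, htan, hcpt, hsplit, hG, hGeq, hEqOn,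
    exists_pos_archERhoG_mul_orbFamGExt_cayRay_eq_of_eqOn L α ν' a' S w₀ hp hU'' hpU'' hEqOn⟩

end TwoChart

end Literature.NumberTheory.Rogawski1990

end
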